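import Mathlib.Tactic.Group
import Literature.Algebra.Lie.SurfaceMagnusAlgebra
import Literature.Algebra.Lie.FreeLieRingEmbeddingGeneral
import Literature.Algebra.Lie.SurfaceGroupGrLie
import Literature.GroupTheory.CombinatorialGroupTheory.MagnusFiltration
import HarnessLib

/-!
# The Magnus representation of the surface group and injectivity of `Φ : 𝔰_g(ℤ) → gr(π₁Σ_g)`

Topic `Literature/Algebra/Lie`. This file proves the hard half of Labute's theorem
(`Literature.Algebra.Lie.Labute1970_grSurfaceGroup`): the canonical morphism
`Φ = SurfaceGr.Phi (g+1) : 𝔰_{g+1}(ℤ) → gr(S_{g+1})` (`Literature/Algebra/Lie/SurfaceGroupGrLie.lean`)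
is injective on every homogeneous piece of degree `≥ 2` (`Phi_eq_zero_imp`; degree `1` is the
abelianisation and is treated in `Literature/Algebra/Lie/SurfaceLieAlgebraProofs.lean`).

The argument is a Magnus-type faithful representation adapted to the one relation, replacing the
`U(gr)`/Birkhoff–Witt argument of Labute's §3 (for which Mathlib lacks the enveloping-algebra
filtration technology) by an explicit module:

* `M = 𝒯_{≤ N}`, the weight-`≤ N` truncation of the free associative ring `𝒯 = ℤ⟨Y⟩` on the
  elimination alphabet `Y = EGen g` (`Literature/Algebra/Lie/SurfaceMagnusAlgebra.lean`), finitely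
  graded by weight (`Gr`);
* the generators act by units of `End_ℤ(M)` congruent to `1` modulo the filtration:
  `a₀ ↦ 1 + L_{a₀}`, `a_{j+1} ↦ 1 + L_{e_{j,a,0}}`, `b_{j+1} ↦ 1 + L_{e_{j,b,0}}` (truncated left
  multiplications) and `b₀ ↦ Σ`, the truncation of the twist `σ` (`e_{j,ε,k} ↦ e_{j,ε,k} + e_{j,ε,k+1}`,
  `a₀ ↦ w(1+a₀) - 1`); the twist is designed so that the surface relation
  `[a₀,b₀] ∏_{j ≥ 1} [aⱼ,bⱼ] = 1` holds EXACTLY in `End(M)ˣ` (`lift_genUnit_surfaceRelator`), giving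
  `ρ : S_{g+1} →* End(M)ˣ` (`rho`);
* the Magnus–Lazard mechanism (`Literature/GroupTheory/CombinatorialGroupTheory/MagnusFiltration.lean`)
  turns `ρ` into a Lie ring morphism `Ψ : gr(S_{g+1}) → End(M)` (`Psi`), and `χ = Ψ ∘ Φ` sends each
  elimination generator `y ∈ Y` of `𝔰_{g+1}` to the left multiplication `L_{e_y}` (`chi_egen`:
  the bracket with `lead₁(Σ - 1)` shifts `e_{j,ε,k} ↦ e_{j,ε,k+1}`);
* hence on the elimination subalgebra `χ ∘ (L(Y) → 𝔰) = L ∘ (L(Y) → 𝒯)` (`chi_liftEHom`); since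
  `𝔰_n` (`n ≥ 2`) is spanned by weight-`n` brackets of the `y`'s
  (`Literature/Algebra/Lie/SurfaceLieAlgebraElimination.lean`), `L` is faithful on light elements and
  `L_ℤ(Y) → ℤ⟨Y⟩` is injective (Witt, `Literature/Algebra/Lie/FreeLieRingEmbeddingGeneral.lean`),
  `χ u = 0` forces `u = 0` for `u ∈ 𝔰_n`, `2 ≤ n ≤ N` (`eq_zero_of_chi_eq_zero`), and a fortiori
  `Φ u = 0 ⟹ u = 0` (`Phi_eq_zero_imp`, taking `N = n`).

Everything is proved; there are no named facts.

## References

* J. P. Labute, On the descending central series of groups with a single defining relation,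
  J. Algebra 14 (1970) 16–23, §3. [Labute1970]
* W. Magnus, Beziehungen zwischen Gruppen und Idealen in einem speziellen Ring, Math. Ann. 111 (1935).
* M. Lazard, Sur les groupes nilpotents et les anneaux de Lie, Ann. ENS 71 (1954), Ch. I–II.
-/

noncomputable section

namespace Literature.Algebra.Lie

namespace SurfaceMagnus

open SurfaceElim SurfaceLieAlgebra MonoidAlgebra
open Literature.GroupTheory.CombinatorialGroupTheory
open Literature.Topology.FourManifolds
open scoped commutatorElement

-- Mathlib idiom: the commutator bracket on an associative ring (here `End_ℤ(M)` and `𝒯`).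
attribute [local instance 100] LieRing.ofAssociativeRing

section Weights

variable {R : Type*} [CommRing R] {X : Type*}

/-- The free-Lie-to-tensor map sends the weight-`n` span of bracket words to the weight-`n` tensors.
[folklore] -/
theorem toTensor_mem_tensorGrade_of_mem_wspan (wt : X → ℕ) {n : ℕ} {v : FreeLieAlgebra R X}
    (hv : v ∈ wspan R (FreeLieAlgebra.of R) wt n) : toTensor R X v ∈ tensorGrade R wt n := by
  have key : wspan R (FreeLieAlgebra.of R) wt n ≤
      (tensorGrade R wt n).comap (toTensor R X : FreeLieAlgebra R X →ₗ[R] MonoidAlgebra R (FreeMonoid X)) := by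
    change Submodule.span R _ ≤ _
    rw [Submodule.span_le]
    rintro _ ⟨w, hw, rfl⟩
    change toTensor R X (bracketWord (FreeLieAlgebra.of R) w) ∈ tensorGrade R wt n
    rw [toTensor_bracketWord]
    have hw' : magmaWeight wt w = n := hw
    rw [← hw']
    exact bracketWord_single_mem_tensorGrade wt w
  exact key hv

/-- The canonical map `L_R(Y) → 𝔰_{g+1}(R)` onto the elimination generators, as an additive map
(stated for a general ring `R`, so that its instance arguments are the generic ones). [folklore] -/
def liftEHom (R : Type*) [CommRing R] (g : ℕ) : FreeLieAlgebra R (EGen g) →+ SurfaceLieAlgebra R (g + 1) :=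
  (FreeLieAlgebra.lift R (egen R g)).toLinearMap.toAddMonoidHom

/-- `liftEHom` on letters. [folklore] -/
theorem liftEHom_of (R : Type*) [CommRing R] (g : ℕ) (y : EGen g) :
    liftEHom R g (FreeLieAlgebra.of R y) = egen R g y :=
  FreeLieAlgebra.lift_of_apply _ y

/-- `liftEHom` preserves brackets. [folklore] -/
theorem liftEHom_lie (R : Type*) [CommRing R] (g : ℕ) (a b : FreeLieAlgebra R (EGen g)) :
    liftEHom R g ⁅a, b⁆ = ⁅liftEHom R g a, liftEHom R g b⁆ :=
  (FreeLieAlgebra.lift R (egen R g)).map_lie a b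

/-- Elements of the elimination span `P_n` lift along `liftEHom` to weight-`n` elements. [folklore] -/
theorem exists_liftEHom_eq (R : Type*) [CommRing R] (g : ℕ) {n : ℕ} {u : SurfaceLieAlgebra R (g + 1)}
    (hu : u ∈ elimSpan R g n) : ∃ v ∈ wspan R (FreeLieAlgebra.of R) (wtE g) n, liftEHom R g v = u :=
  exists_lift_eq_of_mem_elimSpan R g hu

end Weights

variable (g N : ℕ)

/-! ## The weight grading of `M` -/

variable {g N} in
/-- Weight projections preserve lightness. [folklore] -/
theorem tensorProj_mem_light {a : T g} (ha : a ∈ light g N) (i : ℕ) : tensorProj (wtE g) i a ∈ light g N := by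
  refine mem_light_iff.2 fun w hw => ?_
  rw [coeff_tensorProj] at hw
  split_ifs at hw with h
  · exact mem_light_iff.1 ha w hw
  · exact absurd rfl hw

/-- The weight-`i` projection on `M`. [folklore] -/
def projM (i : ℕ) : Module.End ℤ (M g N) :=
  (tensorProj (R := ℤ) (wtE g) i).restrict fun _ ha => tensorProj_mem_light ha i

/-- `projM i` computes `tensorProj i`. [folklore] -/
@[simp] theorem coe_projM (i : ℕ) (x : M g N) : ((projM g N i x : M g N) : T g) = tensorProj (wtE g) i (x : T g) := rfl

/-- **The finite grading of `M = 𝒯_{≤ N}` by weight.** [folklore] -/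
def Gr : FiniteGrading ℤ (M g N) where
  bound := N
  proj := projM g N
  proj_mul_proj i j := by
    split_ifs with h
    · subst h
      refine LinearMap.ext fun x => Subtype.ext ?_
      simp only [Module.End.mul_apply, coe_projM]
      exact tensorProj_apply_of_mem_self (tensorProj_mem _ _ _)
    · refine LinearMap.ext fun x => Subtype.ext ?_
      simp only [Module.End.mul_apply, coe_projM, LinearMap.zero_apply, ZeroMemClass.coe_zero]
      exact tensorProj_apply_of_mem_ne (tensorProj_mem _ _ _) (Ne.symm h)
  proj_eq_zero_of_lt i hi := by
    refine LinearMap.ext fun x => Subtype.ext ?_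
    simp only [coe_projM, LinearMap.zero_apply, ZeroMemClass.coe_zero]
    refine MonoidAlgebra.coeff_injective (Finsupp.ext fun w => ?_)
    rw [coeff_tensorProj, MonoidAlgebra.coeff_zero, Finsupp.zero_apply]
    split_ifs with h
    · by_contra hne
      have := mem_light_iff.1 x.2 w hne
      change ω g w = i at h
      omega
    · rfl
  sum_proj := by
    refine LinearMap.ext fun x => Subtype.ext ?_
    rw [LinearMap.sum_apply, Submodule.coe_sum, Module.End.one_apply]
    simp only [coe_projM]
    refine MonoidAlgebra.coeff_injective (Finsupp.ext fun w => ?_)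
    rw [MonoidAlgebra.coeff_sum, Finsupp.finsetSum_apply]
    simp only [coeff_tensorProj]
    rw [Finset.sum_ite_eq]
    split_ifs with h
    · rfl
    · rw [Finset.mem_range, not_lt] at h
      by_contra hne
      have := mem_light_iff.1 x.2 w (Ne.symm hne)
      change N + 1 ≤ ω g w at h
      omega

variable {g N}

/-- The filtration pieces of the grading are the weight filtration: `x ∈ M_{≥ i} ↔ x ∈ geW i`.
[folklore] -/
theorem mem_ge_iff {i : ℕ} {x : M g N} : x ∈ (Gr g N).ge i ↔ (x : T g) ∈ geW g i := by
  rw [FiniteGrading.mem_ge_iff]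
  constructor
  · intro h
    refine mem_geW_iff.2 fun w hw => ?_
    by_contra hlt
    rw [not_le] at hlt
    have h1 := congrArg (fun y : M g N => (y : T g).coeff w) (h (ω g w) hlt)
    change (tensorProj (wtE g) (ω g w) (x : T g)).coeff w = (0 : T g).coeff w at h1
    rw [coeff_tensorProj, if_pos rfl, MonoidAlgebra.coeff_zero, Finsupp.zero_apply] at h1
    exact hw h1
  · intro h j hj
    refine Subtype.ext ?_
    change tensorProj (wtE g) j (x : T g) = 0
    refine MonoidAlgebra.coeff_injective (Finsupp.ext fun w => ?_)
    rw [coeff_tensorProj, MonoidAlgebra.coeff_zero, Finsupp.zero_apply]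
    split_ifs with hw
    · by_contra hne
      have := mem_geW_iff.1 h w hne
      change ω g w = j at hw
      omega
    · rfl

/-- Left multiplication by an element of weight `≥ k` raises the filtration by `k`. [folklore] -/
theorem Lop_mem_fil {k : ℕ} {u : T g} (hu : u ∈ geW g k) : Lop g N u ∈ (Gr g N).fil k := by
  refine (FiniteGrading.mem_fil_iff _).2 fun i x hx => ?_
  rw [mem_ge_iff] at hx ⊢
  rw [coe_Lop]
  have := mul_mem_geW hu hx
  rw [add_comm] at this
  exact trunc_mem_geW this

/-- Left multiplication by an element of pure weight `k` is homogeneous of degree `k`. [folklore] -/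
theorem Lop_isHomogeneous {k : ℕ} {u : T g} (hu : u ∈ tensorGrade ℤ (wtE g) k) :
    (Gr g N).IsHomogeneous k (Lop g N u) := by
  intro i x
  refine Subtype.ext ?_
  change tensorProj (wtE g) (i + k) (trunc g N (u * tensorProj (wtE g) i (x : T g))) =
    trunc g N (u * tensorProj (wtE g) i (x : T g))
  refine tensorProj_apply_of_mem_self (trunc_mem_tensorGrade ?_)
  have := mul_mem_tensorGrade hu (tensorProj_mem (R := ℤ) (wtE g) i (x : T g))
  rwa [add_comm] at this

/-- **The twist is unipotent**: `Σ - 1 ∈ Fil₁`. [folklore] -/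
theorem Sig_sub_one_mem_fil_one : Sig g N - 1 ∈ (Gr g N).fil 1 := by
  refine (Gr g N).mem_fil_of_apply_proj fun i x => ?_
  rw [mem_ge_iff]
  have hp : ((projM g N i x : M g N) : T g) ∈ tensorGrade ℤ (wtE g) i := tensorProj_mem _ _ _
  have hl : ((projM g N i x : M g N) : T g) ∈ light g N := (projM g N i x).2
  change (((Sig g N - 1) (projM g N i x) : M g N) : T g) ∈ geW g (i + 1)
  rw [LinearMap.sub_apply, Submodule.coe_sub, coe_Sig, Module.End.one_apply]
  have : trunc g N (σT g N ((projM g N i x : M g N) : T g)) - ((projM g N i x : M g N) : T g) =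
      trunc g N (σT g N ((projM g N i x : M g N) : T g) - ((projM g N i x : M g N) : T g)) := by
    rw [map_sub, trunc_of_mem_light hl]
  rw [this]
  exact trunc_mem_geW (σT_sub_self_mem_geW hp)

/-- `Σ ∈ Fil₀`. [folklore] -/
theorem Sig_mem_fil_zero : Sig g N ∈ (Gr g N).fil 0 := by
  have : Sig g N = 1 + (Sig g N - 1) := by abel
  rw [this]
  exact add_mem (Gr g N).one_mem_fil_zero ((Gr g N).fil_antitone (Nat.zero_le 1) Sig_sub_one_mem_fil_one)

/-- Operators in `Fil_{N+1}` vanish (the grading is concentrated in degrees `≤ N`). [folklore] -/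
theorem eq_zero_of_mem_fil_succ {T : Module.End ℤ (M g N)} (hT : T ∈ (Gr g N).fil (N + 1)) : T = 0 := by
  refine LinearMap.ext fun x => ?_
  have hx : x ∈ (Gr g N).ge 0 := fun j hj => absurd hj (Nat.not_lt_zero j)
  have := hT 0 x hx
  exact (Gr g N).eq_zero_of_mem_ge (show (Gr g N).bound < 0 + (N + 1) by change N < 0 + (N + 1); omega) this

/-- Powers of an operator in `Fil₁` climb the filtration. [folklore] -/
theorem pow_mem_fil {T : Module.End ℤ (M g N)} (hT : T ∈ (Gr g N).fil 1) (m : ℕ) : T ^ m ∈ (Gr g N).fil m := by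
  induction m with
  | zero => rw [pow_zero]; exact (Gr g N).one_mem_fil_zero
  | succ m ih => rw [pow_succ]; exact (Gr g N).mul_mem_fil ih hT

/-- Products of operators congruent to `1` modulo `Fil₁` are congruent to `1`. [folklore] -/
theorem mul_sub_one_mem_fil {S T : Module.End ℤ (M g N)} (hS : S - 1 ∈ (Gr g N).fil 1) (hT : T - 1 ∈ (Gr g N).fil 1) :
    S * T - 1 ∈ (Gr g N).fil 1 := by
  rw [mul_sub_one_eq]
  exact add_mem (add_mem hS hT) ((Gr g N).fil_antitone one_le_two ((Gr g N).mul_mem_fil hS hT))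

/-! ## Unipotent units and the representation `ρ` -/

variable (g N)

/-- The unit `1 + T` for `T ∈ Fil₁` (inverse `∑_{m ≤ N} (-T)^m`, as `T^{N+1} = 0`). [folklore] -/
def oneAddUnit (T : Module.End ℤ (M g N)) (hT : T ∈ (Gr g N).fil 1) : (Module.End ℤ (M g N))ˣ where
  val := 1 + T
  inv := ∑ m ∈ Finset.range (N + 1), (-T) ^ m
  val_inv := by
    have h := mul_neg_geom_sum (-T) (N + 1)
    rw [sub_neg_eq_add] at h
    rw [h, eq_zero_of_mem_fil_succ (pow_mem_fil (Submodule.neg_mem _ hT) (N + 1)), sub_zero]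
  inv_val := by
    have h := geom_sum_mul_neg (-T) (N + 1)
    rw [sub_neg_eq_add] at h
    rw [h, eq_zero_of_mem_fil_succ (pow_mem_fil (Submodule.neg_mem _ hT) (N + 1)), sub_zero]

variable {g N}

/-- The value of `oneAddUnit T`. [folklore] -/
@[simp] theorem coe_oneAddUnit (T : Module.End ℤ (M g N)) (hT : T ∈ (Gr g N).fil 1) :
    ((oneAddUnit g N T hT : (Module.End ℤ (M g N))ˣ) : Module.End ℤ (M g N)) = 1 + T := rfl

/-- `oneAddUnit T - 1 = T`. [folklore] -/
theorem oneAddUnit_sub_one (T : Module.End ℤ (M g N)) (hT : T ∈ (Gr g N).fil 1) :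
    ((oneAddUnit g N T hT : (Module.End ℤ (M g N))ˣ) : Module.End ℤ (M g N)) - 1 = T :=
  add_sub_cancel_left 1 T

/-- Both `oneAddUnit T` and its inverse are congruent to `1` modulo `Fil₁`. [folklore] -/
theorem oneAddUnit_mem_pair (T : Module.End ℤ (M g N)) (hT : T ∈ (Gr g N).fil 1) :
    ((oneAddUnit g N T hT : (Module.End ℤ (M g N))ˣ) : Module.End ℤ (M g N)) - 1 ∈ (Gr g N).fil 1 ∧
      (((oneAddUnit g N T hT)⁻¹ : (Module.End ℤ (M g N))ˣ) : Module.End ℤ (M g N)) - 1 ∈ (Gr g N).fil 1 := by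
  refine ⟨by rw [oneAddUnit_sub_one]; exact hT, ?_⟩
  change ∑ m ∈ Finset.range (N + 1), (-T) ^ m - 1 ∈ (Gr g N).fil 1
  rw [Finset.sum_range_succ', pow_zero, add_sub_cancel_right]
  refine Submodule.sum_mem _ fun m _ => ?_
  exact (Gr g N).fil_antitone (show 1 ≤ m + 1 by omega) (pow_mem_fil (Submodule.neg_mem _ hT) (m + 1))

variable (g N)

/-- `ρ(a₀) = 1 + L_{a₀}`. [folklore] -/
def UA0 : (Module.End ℤ (M g N))ˣ := oneAddUnit g N (Lop g N (e g none)) (Lop_mem_fil e_none_mem_geW)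

/-- `ρ(b₀) = Σ`. [folklore] -/
def UB0 : (Module.End ℤ (M g N))ˣ := oneAddUnit g N (Sig g N - 1) Sig_sub_one_mem_fil_one

/-- `ρ(a_{j+1}) = 1 + L_{e_{j,a,0}}`. [folklore] -/
def UA (j : Fin g) : (Module.End ℤ (M g N))ˣ :=
  oneAddUnit g N (Lop g N (e g (some (j, false, 0)))) (Lop_mem_fil (e_some_mem_geW j false 0))

/-- `ρ(b_{j+1}) = 1 + L_{e_{j,b,0}}`. [folklore] -/
def UB (j : Fin g) : (Module.End ℤ (M g N))ˣ :=
  oneAddUnit g N (Lop g N (e g (some (j, true, 0)))) (Lop_mem_fil (e_some_mem_geW j true 0))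

/-- The images of the generators of `S_{g+1}` (index `0` is the distinguished pair). [folklore] -/
def genUnit (x : Fin (g + 1) × Bool) : (Module.End ℤ (M g N))ˣ :=
  Fin.cases (motive := fun _ => (Module.End ℤ (M g N))ˣ)
    (cond x.2 (UB0 g N) (UA0 g N)) (fun j => cond x.2 (UB g N j) (UA g N j)) x.1

/-- `genUnit (0, a) = ρ a₀`. [folklore] -/
@[simp] theorem genUnit_zero_false : genUnit g N (0, false) = UA0 g N := rfl
/-- `genUnit (0, b) = ρ b₀`. [folklore] -/
@[simp] theorem genUnit_zero_true : genUnit g N (0, true) = UB0 g N := rfl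
/-- `genUnit (j+1, a) = ρ a_{j+1}`. [folklore] -/
@[simp] theorem genUnit_succ_false (j : Fin g) : genUnit g N (j.succ, false) = UA g N j := rfl
/-- `genUnit (j+1, b) = ρ b_{j+1}`. [folklore] -/
@[simp] theorem genUnit_succ_true (j : Fin g) : genUnit g N (j.succ, true) = UB g N j := rfl

/-- `ρ a₀ = L_{1 + a₀}`. [folklore] -/
theorem coe_UA0 : ((UA0 g N : (Module.End ℤ (M g N))ˣ) : Module.End ℤ (M g N)) = Lop g N (1 + e g none) := by
  rw [map_add, map_one]; rfl

/-- `ρ b₀ = Σ`. [folklore] -/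
theorem coe_UB0 : ((UB0 g N : (Module.End ℤ (M g N))ˣ) : Module.End ℤ (M g N)) = Sig g N :=
  add_sub_cancel 1 (Sig g N)

/-- `ρ a_{j+1} = L_{1 + e_{j,a,0}}`. [folklore] -/
theorem coe_UA (j : Fin g) :
    ((UA g N j : (Module.End ℤ (M g N))ˣ) : Module.End ℤ (M g N)) = Lop g N (1 + e g (some (j, false, 0))) := by
  rw [map_add, map_one]; rfl

/-- `ρ b_{j+1} = L_{1 + e_{j,b,0}}`. [folklore] -/
theorem coe_UB (j : Fin g) :
    ((UB g N j : (Module.End ℤ (M g N))ˣ) : Module.End ℤ (M g N)) = Lop g N (1 + e g (some (j, true, 0))) := by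
  rw [map_add, map_one]; rfl

/-- `(ρ a_{j+1})⁻¹ = L_{invT e_{j,a,0}}`. [folklore] -/
theorem coe_UA_inv (j : Fin g) :
    (((UA g N j)⁻¹ : (Module.End ℤ (M g N))ˣ) : Module.End ℤ (M g N)) = Lop g N (invT N (e g (some (j, false, 0)))) :=
  Units.inv_eq_of_mul_eq_one_right (by rw [coe_UA, Lop_one_add_mul_Lop_invT (e_some_mem_geW j false 0)])

/-- `(ρ b_{j+1})⁻¹ = L_{invT e_{j,b,0}}`. [folklore] -/
theorem coe_UB_inv (j : Fin g) :
    (((UB g N j)⁻¹ : (Module.End ℤ (M g N))ˣ) : Module.End ℤ (M g N)) = Lop g N (invT N (e g (some (j, true, 0)))) :=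
  Units.inv_eq_of_mul_eq_one_right (by rw [coe_UB, Lop_one_add_mul_Lop_invT (e_some_mem_geW j true 0)])

/-- The commutator `[ρ a_{j+1}, ρ b_{j+1}]`. [folklore] -/
def comU (j : Fin g) : (Module.End ℤ (M g N))ˣ := UA g N j * UB g N j * (UA g N j)⁻¹ * (UB g N j)⁻¹

/-- `[ρ a_{j+1}, ρ b_{j+1}] = L_{Cⱼ}`. [folklore] -/
theorem coe_comU (j : Fin g) : ((comU g N j : (Module.End ℤ (M g N))ˣ) : Module.End ℤ (M g N)) = Lop g N (Cfac g N j) := by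
  rw [comU, Units.val_mul, Units.val_mul, Units.val_mul, coe_UA, coe_UB, coe_UA_inv, coe_UB_inv, Cfac,
    map_mul, map_mul, map_mul]

/-- `∏_{j ≥ 1} [ρ aⱼ, ρ bⱼ]`. [folklore] -/
def wU : (Module.End ℤ (M g N))ˣ := ((List.finRange g).map (comU g N)).prod

/-- `∏_{j ≥ 1} [ρ aⱼ, ρ bⱼ] = L_w`. [folklore] -/
theorem coe_wU : ((wU g N : (Module.End ℤ (M g N))ˣ) : Module.End ℤ (M g N)) = Lop g N (wEl g N) := by
  unfold wU wEl
  rw [← Units.coeHom_apply, map_list_prod, map_list_prod, List.map_map, List.map_map]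
  exact congrArg List.prod (List.map_congr_left fun j _ => coe_comU g N j)

/-- **The twisted relation**: `L_w (1 + L_{a₀}) Σ = Σ (1 + L_{a₀})`, i.e. `w · ρa₀ · ρb₀ = ρb₀ · ρa₀`.
[folklore] -/
theorem wU_mul_UA0_mul_UB0 : wU g N * UA0 g N * UB0 g N = UB0 g N * UA0 g N := by
  refine Units.ext ?_
  simp only [Units.val_mul, coe_wU, coe_UA0, coe_UB0]
  rw [Sig_mul_Lop, σT_one_add_e_none, map_mul]

/-- `[ρa₀, ρb₀] · ∏_{j ≥ 1} [ρaⱼ, ρbⱼ] = 1`. [folklore] -/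
theorem headComm_mul_wU : UA0 g N * UB0 g N * (UA0 g N)⁻¹ * (UB0 g N)⁻¹ * wU g N = 1 := by
  have h := wU_mul_UA0_mul_UB0 g N
  have h' : wU g N = UB0 g N * UA0 g N * (UB0 g N)⁻¹ * (UA0 g N)⁻¹ := by
    rw [← h]; group
  rw [h']; group

/-- **The surface relator holds in `End(M)ˣ`.** [folklore] -/
theorem lift_genUnit_surfaceRelator : FreeGroup.lift (genUnit g N) (surfaceRelator (g + 1)) = 1 := by
  have hrel : surfaceRelator (g + 1) = (genA 0 * genB 0 * (genA 0)⁻¹ * (genB 0)⁻¹) *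
      ((List.finRange g).map fun j : Fin g =>
        genA j.succ * genB j.succ * (genA j.succ)⁻¹ * (genB j.succ)⁻¹).prod := by
    unfold surfaceRelator
    rw [List.finRange_succ, List.map_cons, List.prod_cons, List.map_map]
    rfl
  have htail : ((List.finRange g).map (⇑(FreeGroup.lift (genUnit g N)) ∘ fun j : Fin g =>
      genA j.succ * genB j.succ * (genA j.succ)⁻¹ * (genB j.succ)⁻¹)).prod = wU g N := by
    unfold wU
    exact congrArg List.prod (List.map_congr_left fun j _ => by simp [comU, genA, genB])
  rw [hrel, map_mul, map_list_prod, List.map_map, htail]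
  simp only [map_mul, map_inv, genA, genB, FreeGroup.lift_apply_of, genUnit_zero_false, genUnit_zero_true]
  exact headComm_mul_wU g N

/-- **The Magnus representation `ρ : S_{g+1} →* End(M)ˣ`.**
[cite: Labute1970, §3 (the comparison of gr(G) with a filtered ring)] -/
def rho : SurfaceGroup (g + 1) →* (Module.End ℤ (M g N))ˣ :=
  PresentedGroup.toGroup (f := genUnit g N) (by
    intro r hr
    rw [Set.mem_singleton_iff.1 hr]
    exact lift_genUnit_surfaceRelator g N)

/-- `ρ` on generators. [folklore] -/
@[simp] theorem rho_of (x : Fin (g + 1) × Bool) : rho g N (PresentedGroup.of x) = genUnit g N x :=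
  PresentedGroup.toGroup.of _

/-- The generators and their inverses are congruent to `1` modulo `Fil₁`. [folklore] -/
theorem genUnit_mem_pair (x : Fin (g + 1) × Bool) :
    ((genUnit g N x : (Module.End ℤ (M g N))ˣ) : Module.End ℤ (M g N)) - 1 ∈ (Gr g N).fil 1 ∧
      (((genUnit g N x)⁻¹ : (Module.End ℤ (M g N))ˣ) : Module.End ℤ (M g N)) - 1 ∈ (Gr g N).fil 1 := by
  obtain ⟨i, ε⟩ := x
  refine Fin.cases ?_ (fun j => ?_) i
  · cases ε
    · exact oneAddUnit_mem_pair _ (Lop_mem_fil e_none_mem_geW)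
    · exact oneAddUnit_mem_pair _ Sig_sub_one_mem_fil_one
  · cases ε
    · exact oneAddUnit_mem_pair _ (Lop_mem_fil (e_some_mem_geW j false 0))
    · exact oneAddUnit_mem_pair _ (Lop_mem_fil (e_some_mem_geW j true 0))

/-- **`ρ ≡ 1 (mod Fil₁)`** on the whole group. [folklore] -/
theorem rho_sub_one_mem (γ : SurfaceGroup (g + 1)) :
    ((rho g N γ : (Module.End ℤ (M g N))ˣ) : Module.End ℤ (M g N)) - 1 ∈ ((Gr g N).fil 1).toAddSubgroup := by
  have hγ : γ ∈ Subgroup.closure (Set.range (PresentedGroup.of : Fin (g + 1) × Bool → SurfaceGroup (g + 1))) := by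
    rw [PresentedGroup.closure_range_of]; exact Subgroup.mem_top γ
  have key := Subgroup.closure_induction
    (p := fun γ _ => ((rho g N γ : (Module.End ℤ (M g N))ˣ) : Module.End ℤ (M g N)) - 1 ∈ (Gr g N).fil 1 ∧
      ((rho g N γ⁻¹ : (Module.End ℤ (M g N))ˣ) : Module.End ℤ (M g N)) - 1 ∈ (Gr g N).fil 1)
    (by
      rintro _ ⟨x, rfl⟩
      rw [map_inv, rho_of]
      exact genUnit_mem_pair g N x)
    (by simp only [map_one, inv_one, Units.val_one, sub_self]; exact ⟨zero_mem _, zero_mem _⟩)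
    (by
      intro x y _ _ hx hy
      rw [mul_inv_rev, map_mul, map_mul, Units.val_mul, Units.val_mul]
      exact ⟨mul_sub_one_mem_fil hx.1 hy.1, mul_sub_one_mem_fil hy.2 hx.2⟩)
    (by
      intro x _ hx
      rw [inv_inv]
      exact ⟨hx.2, hx.1⟩)
    hγ
  exact key.1

/-! ## The Lie ring morphisms `Ψ : gr(S_{g+1}) → End(M)` and `χ = Ψ ∘ Φ` -/

/-- **`Ψ : gr(S_{g+1}) →ₗ⁅ℤ⁆ End_ℤ(M)`**, `toGr n x ↦ lead_{n+1}(ρ x - 1)` (Magnus–Lazard). [folklore] -/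
def Psi :=
  magnusLieHom (Gr g N).isDescFiltration (rho g N) (rho_sub_one_mem g N)
    (fun k => ((Gr g N).lead k).toAddMonoidHom) (Gr g N).isLeadingTerm

variable {g N} in
/-- `Ψ` on symbols. [folklore] -/
theorem Psi_toGr {n : ℕ} {x : SurfaceGroup (g + 1)} (hx : x ∈ lcs (SurfaceGroup (g + 1)) n) :
    Psi g N (toGr (SurfaceGroup (g + 1)) n x) =
      (Gr g N).lead (n + 1) (((rho g N x : (Module.End ℤ (M g N))ˣ) : Module.End ℤ (M g N)) - 1) :=
  magnusLieHom_toGr _ _ _ _ _ hx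

/-- **`χ = Ψ ∘ Φ : 𝔰_{g+1}(ℤ) →ₗ⁅ℤ⁆ End_ℤ(M)`.** [folklore] -/
def chi := (Psi g N).comp (SurfaceGr.Phi (g + 1))

/-- `χ u = Ψ (Φ u)`. [folklore] -/
theorem chi_apply (u : SurfaceLieAlgebra ℤ (g + 1)) : chi g N u = Psi g N (SurfaceGr.Phi (g + 1) u) := rfl

/-- `χ` on a generator is the leading term of `ρ(generator) - 1`. [folklore] -/
theorem chi_gen (x : Fin (g + 1) × Bool) :
    chi g N (gen ℤ (g + 1) x) = (Gr g N).lead 1 (((genUnit g N x : (Module.End ℤ (M g N))ˣ) : Module.End ℤ (M g N)) - 1) := by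
  rw [chi_apply, SurfaceGr.Phi_gen, Psi_toGr (Subgroup.mem_top _), rho_of]

/-- `χ(a₀) = L_{a₀}`. [folklore] -/
theorem chi_a_zero : chi g N (SurfaceLieAlgebra.a ℤ (g + 1) 0) = Lop g N (e g none) := by
  change chi g N (gen ℤ (g + 1) (0, false)) = _
  rw [chi_gen, genUnit_zero_false, UA0, oneAddUnit_sub_one]
  exact (Gr g N).lead_eq_self (Lop_isHomogeneous (e_mem_tensorGrade none))

/-- `χ(x_{j+1,ε}) = L_{e_{j,ε,0}}`. [folklore] -/
theorem chi_gen_succ (j : Fin g) (ε : Bool) : chi g N (gen ℤ (g + 1) (j.succ, ε)) = Lop g N (e g (some (j, ε, 0))) := by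
  rw [chi_gen]
  cases ε
  · rw [genUnit_succ_false, UA, oneAddUnit_sub_one]
    exact (Gr g N).lead_eq_self (Lop_isHomogeneous (e_mem_tensorGrade (some (j, false, 0))))
  · rw [genUnit_succ_true, UB, oneAddUnit_sub_one]
    exact (Gr g N).lead_eq_self (Lop_isHomogeneous (e_mem_tensorGrade (some (j, true, 0))))

/-- `χ(b₀) = lead₁(Σ - 1)`. [folklore] -/
theorem chi_b_zero : chi g N (SurfaceLieAlgebra.b ℤ (g + 1) 0) = (Gr g N).lead 1 (Sig g N - 1) := by
  change chi g N (gen ℤ (g + 1) (0, true)) = _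
  rw [chi_gen, genUnit_zero_true, UB0, oneAddUnit_sub_one]

/-- **The shift**: `⁅lead₁(Σ - 1), L_{e_{j,ε,k}}⁆ = L_{e_{j,ε,k+1}}`. [folklore] -/
theorem lead_Sig_lie_Lop_e (j : Fin g) (ε : Bool) (k : ℕ) :
    ⁅(Gr g N).lead 1 (Sig g N - 1), Lop g N (e g (some (j, ε, k)))⁆ = Lop g N (e g (some (j, ε, k + 1))) := by
  have hu : e g (some (j, ε, k)) ∈ tensorGrade ℤ (wtE g) (k + 1) := e_mem_tensorGrade (some (j, ε, k))
  have hσ : σT g N (e g (some (j, ε, k))) - e g (some (j, ε, k)) = e g (some (j, ε, k + 1)) := by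
    rw [σT_e, σgen_some, add_sub_cancel_left]
  have hD : Sig g N - 1 ∈ (Gr g N).fil 1 := Sig_sub_one_mem_fil_one
  have hL : Lop g N (e g (some (j, ε, k))) ∈ (Gr g N).fil (k + 1) := Lop_mem_fil (tensorGrade_le_geW _ hu)
  have hLop : Lop g N (e g (some (j, ε, k))) = (Gr g N).lead (k + 1) (Lop g N (e g (some (j, ε, k)))) :=
    ((Gr g N).lead_eq_self (Lop_isHomogeneous hu)).symm
  rw [hLop]
  have hlie := (Gr g N).isLeadingTerm.lie 1 (k + 1) (Sig g N - 1) (Lop g N (e g (some (j, ε, k)))) hD hL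
  change ⁅(Gr g N).lead 1 (Sig g N - 1), (Gr g N).lead (k + 1) (Lop g N (e g (some (j, ε, k))))⁆ =
    (Gr g N).lead (1 + (k + 1)) ((Sig g N - 1) * Lop g N (e g (some (j, ε, k))) -
      Lop g N (e g (some (j, ε, k))) * (Sig g N - 1)) at hlie
  rw [hlie]
  have hcomm : (Sig g N - 1) * Lop g N (e g (some (j, ε, k))) - Lop g N (e g (some (j, ε, k))) * (Sig g N - 1) =
      Lop g N (e g (some (j, ε, k + 1))) * Sig g N := by
    rw [sub_mul, mul_sub, one_mul, mul_one, Sig_mul_Lop, ← hσ, map_sub, sub_mul]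
    abel
  rw [hcomm]
  have h1 : Lop g N (e g (some (j, ε, k + 1))) ∈ (Gr g N).fil (1 + (k + 1)) :=
    Lop_mem_fil (by rw [show 1 + (k + 1) = k + 1 + 1 by omega]; exact e_some_mem_geW j ε (k + 1))
  have h3 := (Gr g N).lead_mul h1 (Sig_mem_fil_zero (g := g) (N := N))
  rw [add_zero] at h3
  rw [h3]
  have hS0 : (Gr g N).lead 0 (Sig g N) = 1 := by
    have e1 : Sig g N = 1 + (Sig g N - 1) := by abel
    rw [e1]
    exact (Gr g N).lead_zero_one_add hD
  rw [hS0, mul_one, show 1 + (k + 1) = k + 1 + 1 by omega]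
  exact (Gr g N).lead_eq_self (Lop_isHomogeneous (e_mem_tensorGrade (some (j, ε, k + 1))))

/-- **`χ` on the elimination generators is left multiplication by the letter**: `χ(y) = L_{e_y}`.
[folklore] -/
theorem chi_egen (y : EGen g) : chi g N (egen ℤ g y) = Lop g N (e g y) := by
  rcases y with _ | ⟨j, ε, k⟩
  · rw [egen_none]; exact chi_a_zero g N
  · induction k with
    | zero => rw [egen_zero]; exact chi_gen_succ g N j ε
    | succ k ih =>
      rw [← adb_egen_some (R := ℤ), adb_apply, LieHom.map_lie, ih, chi_b_zero]
      exact lead_Sig_lie_Lop_e g N j ε k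

/-- **`χ ∘ (L(Y) → 𝔰) = L ∘ (L(Y) → 𝒯)`**: on the image of the free Lie ring on the elimination
alphabet, `χ` is left multiplication by the tensor expansion. [folklore] -/
theorem chi_liftEHom (v : FreeLieAlgebra ℤ (EGen g)) :
    chi g N (liftEHom ℤ g v) = Lop g N (toTensor ℤ (EGen g) v) := by
  have key : (chi g N).toLinearMap.toAddMonoidHom.comp (liftEHom ℤ g) =
      ((Lop g N : T g →+* Module.End ℤ (M g N)) : T g →+ Module.End ℤ (M g N)).comp
        (toTensor ℤ (EGen g)).toLinearMap.toAddMonoidHom := by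
    refine addMonoidHom_ext_of_map_lie ?_ ?_ ?_
    · intro a b
      change chi g N (liftEHom ℤ g ⁅a, b⁆) = ⁅chi g N (liftEHom ℤ g a), chi g N (liftEHom ℤ g b)⁆
      rw [liftEHom_lie, LieHom.map_lie]
    · intro a b
      change Lop g N (toTensor ℤ (EGen g) ⁅a, b⁆) = ⁅Lop g N (toTensor ℤ (EGen g) a), Lop g N (toTensor ℤ (EGen g) b)⁆
      rw [LieHom.map_lie, LieRing.of_associative_ring_bracket, LieRing.of_associative_ring_bracket, map_sub,
        map_mul, map_mul]
    · intro y
      change chi g N (liftEHom ℤ g (FreeLieAlgebra.of ℤ y)) = Lop g N (toTensor ℤ (EGen g) (FreeLieAlgebra.of ℤ y))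
      rw [liftEHom_of, toTensor_of, chi_egen]
      rfl
  exact DFunLike.congr_fun key v

/-! ## Injectivity -/

variable {g N}

/-- **`χ` detects `𝔰_n` for `2 ≤ n ≤ N`**: `u ∈ 𝔰_n`, `χ u = 0` ⟹ `u = 0`. [folklore] -/
theorem eq_zero_of_chi_eq_zero {n : ℕ} (hn : 2 ≤ n) (hnN : n ≤ N) {u : SurfaceLieAlgebra ℤ (g + 1)}
    (hu : u ∈ grade ℤ (g + 1) n) (h0 : chi g N u = 0) : u = 0 := by
  obtain ⟨v, hv, rfl⟩ := exists_liftEHom_eq ℤ g (grade_le_elimSpan ℤ g hn hu)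
  rw [chi_liftEHom] at h0
  have ht : toTensor ℤ (EGen g) v ∈ tensorGrade ℤ (wtE g) n := toTensor_mem_tensorGrade_of_mem_wspan (wtE g) hv
  have h1 : toTensor ℤ (EGen g) v = 0 := eq_zero_of_Lop_eq_zero (tensorGrade_le_light hnN ht) h0
  have h2 : v = 0 := toTensor_int_injective_of_any (EGen g) (by rw [h1, map_zero])
  rw [h2, map_zero]

end SurfaceMagnus

/-- **Injectivity of `Φ : 𝔰_{g+1}(ℤ) → gr(S_{g+1})` in degrees `≥ 2`** (the hard half of Labute's
theorem): for `u ∈ 𝔰_n`, `n ≥ 2`, `Φ u = 0 ⟹ u = 0`.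
[cite: Labute1970, §1 Theorem and §3] -/
theorem SurfaceGr.Phi_eq_zero_imp {g n : ℕ} (hn : 2 ≤ n) {u : SurfaceLieAlgebra ℤ (g + 1)}
    (hu : u ∈ SurfaceLieAlgebra.grade ℤ (g + 1) n) (h0 : SurfaceGr.Phi (g + 1) u = 0) : u = 0 :=
  SurfaceMagnus.eq_zero_of_chi_eq_zero (N := n) hn le_rfl hu (by rw [SurfaceMagnus.chi_apply, h0, map_zero])

end Literature.Algebra.Lie
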